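import Literature.Analysis.FluidPDE.ShellDivergence
import Literature.Analysis.FluidPDE.WholeSpaceIBP
import Summits.FinalStateConjecture.FinalStateConjecture.Theorems.EIHFluxBalanceLLBalanceLawSphere

/-!
# Route EIHFluxBalance — crux `InertialRecession`: Gauss–Green on balls and perforated balls of `E3`

Helper file (`--supports stmt-FinalStateConjecture-10166`) for the crux
`Summit.FinalStateConjecture.FinalStateConjecture.Theses.EIHFluxBalance.InertialRecession`, shared
by both live lines (`sublinear-is-free-clean-window-charges`: "perforated Gauss for additivity";
`old-light-leaves-the-cone`: missing lemmas `ShellGaussLaw` (S2 census, M2) and `PerforatedGauss`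
(S3b, M3)). The Landau–Lifshitz quasi-local momentum of a coordinate sphere is the flux of the
vector field `h^{μ0·}` through it; ADDITIVITY of these charges over a window — outer sphere minus
the inner spheres around the holes equals the bulk integral of `Σ_j ∂_j h^{μ0j} = (−g)(T + t)^{μ0}`
over the perforated ball — is the divergence theorem for a ball minus finitely many disjoint
balls, for a field that is `C¹` only NEAR the perforated region (black holes sit inside the inner
balls). This file supplies the Euclidean part, for `E3 = ℝ³` with Lebesgue measure and the
Hausdorff surface measure `μHE[2]` on coordinate spheres:
* `exists_smooth_plateau` — a `C^∞` function equal to `1` near a compact `K` with `tsupport`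
  inside a given open `U ⊇ K` (smooth Urysohn); `contDiff_smul_of_tsupport_subset` — `Ψ • V` is
  globally `C¹` when `V` is `C¹` on `U ⊇ tsupport Ψ` (so a field known only near `K` has a global
  `C¹` stand-in that agrees with it near `K`);
* `setIntegral_ball_divergence` — **Gauss–Green on a ball** for a global `C¹` field:
  `∫_{|y−ξ|<r} div V = ∮_{|y−ξ|=r} ⟪(y − ξ)/r, V⟫ dμHE[2]` (the tree's shell theorem
  `FluidPDE.setIntegral_shell_divergence_eq` on `{a < |x| < r}` and `a → 0⁺`);
* `setIntegral_ball_eq_perforated_add_sum` — `∫_{ball} f = ∫_{perforated ball} f + Σ_j ∫_{hole j} f`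
  for disjoint holes inside the ball, the perforated ball written as the CLOSED region
  `{|y − c| ≤ R, |y − ξ_j| ≥ ρ_j}` (spheres are Lebesgue-null).
Evans–Gariepy 1992, §5.8 Thm. 1 (Gauss–Green) for these piecewise-smooth domains. [folklore]
-/

set_option linter.dupNamespace false

noncomputable section

open Set Metric Filter MeasureTheory MeasureTheory.Measure Module
open scoped Topology ContDiff RealInnerProductSpace Manifold

namespace Summit.FinalStateConjecture.FinalStateConjecture.Theorems

namespace LLGauss

open Literature.Geometry.Lorentzian Literature.Analysis.FluidPDE LLBalance

/-! ### Smooth plateau functions and global `C¹` stand-ins -/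

/-- **Smooth plateau.** For a compact `K` inside an open `U ⊆ E3` there is a `C^∞` function `Ψ`
with `Ψ = 1` near every point of `K` and `tsupport Ψ ⊆ U` (Mathlib's smooth Urysohn lemma
`exists_contMDiffMap_zero_one_nhds_of_isClosed`). [folklore] -/
theorem exists_smooth_plateau {K U : Set E3} (hK : IsCompact K) (hU : IsOpen U) (hKU : K ⊆ U) :
    ∃ Ψ : E3 → ℝ, ContDiff ℝ ∞ Ψ ∧ (∀ x ∈ K, Ψ =ᶠ[𝓝 x] fun _ ↦ 1) ∧ tsupport Ψ ⊆ U := by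
  obtain ⟨f, hf0, hf1, -⟩ := exists_contMDiffMap_zero_one_nhds_of_isClosed (I := 𝓘(ℝ, E3))
    (M := E3) (n := (⊤ : ℕ∞)) hU.isClosed_compl hK.isClosed (disjoint_compl_left_iff.2 hKU)
  refine ⟨f, f.contMDiff.contDiff, fun x hx ↦ (eventually_nhdsSet_iff_forall.1 hf1) x hx,
    fun x hx ↦ ?_⟩
  by_contra hxU
  have h0 : (fun y ↦ (f : E3 → ℝ) y) =ᶠ[𝓝 x] 0 := by
    filter_upwards [(eventually_nhdsSet_iff_forall.1 hf0) x hxU] with y hy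
    exact hy
  exact (notMem_tsupport_iff_eventuallyEq.2 h0) hx

/-- **Global `C¹` stand-in.** If `Ψ` is `C^∞` with `tsupport Ψ ⊆ U`, `U` open, and `V` is `C¹`
on `U`, then `Ψ • V` is `C¹` on all of `E3` (near a point outside `U` it vanishes identically).
[folklore] -/
theorem contDiff_smul_of_tsupport_subset {Ψ : E3 → ℝ} {V : E3 → E3} {U : Set E3} (hU : IsOpen U)
    (hΨ : ContDiff ℝ ∞ Ψ) (hsupp : tsupport Ψ ⊆ U) (hV : ContDiffOn ℝ 1 V U) :
    ContDiff ℝ 1 fun x ↦ Ψ x • V x := by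
  refine contDiff_iff_contDiffAt.2 fun x ↦ ?_
  by_cases hx : x ∈ U
  · exact ((hΨ.of_le (mod_cast le_top)).contDiffAt).smul (hV.contDiffAt (hU.mem_nhds hx))
  · have h0 : (fun y ↦ Ψ y • V y) =ᶠ[𝓝 x] fun _ ↦ 0 := by
      filter_upwards [notMem_tsupport_iff_eventuallyEq.1 fun h ↦ hx (hsupp h)] with y hy
      rw [hy, Pi.zero_apply, zero_smul]
    exact contDiffAt_const.congr_of_eventuallyEq h0

/-- Near a point where `Ψ = 1`, the stand-in `Ψ • V` agrees with `V`; in particular their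
derivatives agree there. [folklore] -/
theorem fderiv_smul_eq_of_plateau {Ψ : E3 → ℝ} {V : E3 → E3} {x : E3}
    (h1 : Ψ =ᶠ[𝓝 x] fun _ ↦ 1) :
    fderiv ℝ (fun y ↦ Ψ y • V y) x = fderiv ℝ V x := by
  refine Filter.EventuallyEq.fderiv_eq ?_
  filter_upwards [h1] with y hy
  rw [hy, one_smul]

/-! ### Gauss–Green on a ball for a global `C¹` field -/

/-- Translating a Lebesgue set integral on `E3`: `∫_{S} f = ∫_{(· + ξ)⁻¹ S} f(x + ξ) dx`. [folklore] -/
theorem setIntegral_eq_preimage_add_right (ξ : E3) (f : E3 → ℝ) (S : Set E3) :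
    ∫ y in S, f y = ∫ x in (fun x ↦ x + ξ) ⁻¹' S, f (x + ξ) :=
  ((measurePreserving_add_right volume ξ).setIntegral_preimage_emb
    (MeasurableEquiv.addRight ξ).measurableEmbedding f S).symm

/-- **Gauss–Green on a centred ball**, radial form: for `V ∈ C¹(E3; E3)` and `b > 0`,
`∫_{|x|<b} div V = b² ∫ ⟪α, V(bα)⟫ dσ(α)` (`σ = volume.toSphere`), obtained from the shell theorem
`setIntegral_shell_divergence_eq` on `{a < |x| < b}` by letting `a → 0⁺` (the inner flux is
`a · ∫ ⟪aα, V(aα)⟫/a… = O(a²)`). [folklore] -/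
theorem setIntegral_ball_zero_divergence {V : E3 → E3} (hV : ContDiff ℝ 1 V) {b : ℝ} (hb : 0 < b) :
    ∫ x in ball (0 : E3) b, VectorCalculus.divergence V x =
      b ^ 2 * sphereIntegral volume (fun x ↦ ⟪‖x‖⁻¹ • x, V x⟫) b := by
  set dV : E3 → ℝ := VectorCalculus.divergence V with hdV
  set S : ℝ → ℝ := sphereIntegral volume (fun x ↦ ⟪‖x‖⁻¹ • x, V x⟫) with hS
  have hdVc : Continuous dV := continuous_divergence (hV.continuous_fderiv one_ne_zero)
  -- the radii `a k = b / (k + 2) → 0⁺` and the increasing shells `{a k < |x| < b}`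
  set a : ℕ → ℝ := fun k ↦ b / ((k : ℝ) + 2) with ha
  have ha_pos : ∀ k, 0 < a k := fun k ↦ div_pos hb (by positivity)
  have ha_le : ∀ k, a k ≤ b := fun k ↦ by
    rw [ha]
    exact div_le_self hb.le (by linarith [(Nat.cast_nonneg k : (0:ℝ) ≤ k)])
  have ha_tend : Tendsto a atTop (𝓝 0) := by
    have h : Tendsto (fun k : ℕ ↦ (k : ℝ) + 2) atTop atTop :=
      tendsto_atTop_add_const_right _ _ tendsto_natCast_atTop_atTop
    exact h.const_div_atTop b
  have ha_anti : Antitone a := fun k l hkl ↦ by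
    simp only [ha]
    exact div_le_div_of_nonneg_left hb.le (by positivity) (by exact_mod_cast Nat.add_le_add_right hkl 2)
  set s : ℕ → Set E3 := fun k ↦ {x : E3 | a k < ‖x‖ ∧ ‖x‖ < b} with hs
  have hsm : ∀ k, MeasurableSet (s k) := fun k ↦ measurableSet_shell (a k) b
  have hs_mono : Monotone s := fun k l hkl x hx ↦ ⟨(ha_anti hkl).trans_lt hx.1, hx.2⟩
  have hs_union : (⋃ k, s k) = ball (0 : E3) b \ {0} := by
    ext x
    simp only [mem_iUnion, hs, mem_setOf_eq, Set.mem_sdiff, mem_ball, dist_zero_right,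
      mem_singleton_iff]
    constructor
    · rintro ⟨k, hk1, hk2⟩
      refine ⟨hk2, fun h ↦ ?_⟩
      rw [h, norm_zero] at hk1
      linarith [ha_pos k]
    · rintro ⟨hxb, hx0⟩
      have hxpos : 0 < ‖x‖ := norm_pos_iff.2 hx0
      obtain ⟨k, hk⟩ := (ha_tend.eventually (gt_mem_nhds hxpos)).exists
      exact ⟨k, hk, hxb⟩
  -- the bulk side converges to the integral over the ball
  have hint : IntegrableOn dV (ball (0 : E3) b) :=
    (hdVc.continuousOn.integrableOn_compact (isCompact_closedBall 0 b)).mono_set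
      ball_subset_closedBall
  have hball_ae : (ball (0 : E3) b \ {0} : Set E3) =ᵐ[volume] ball (0 : E3) b :=
    sdiff_null_ae_eq_self (measure_singleton 0)
  have hL : Tendsto (fun k ↦ ∫ x in s k, dV x) atTop (𝓝 (∫ x in ball (0 : E3) b, dV x)) := by
    have h := tendsto_setIntegral_of_monotone (μ := volume) (f := dV) hsm hs_mono
      (by rw [hs_union]; exact hint.mono_set sdiff_subset)
    rwa [hs_union, setIntegral_congr_set hball_ae] at h
  -- the inner flux `a² S(a) = a · ∫ ⟪aα, V(aα)⟫ dσ → 0`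
  set T : ℝ → ℝ := sphereIntegral volume (fun x ↦ ⟪x, V x⟫) with hT
  have hTc : Continuous T := continuous_sphereIntegral volume (continuous_id.inner hV.continuous)
  have hST : ∀ r, 0 < r → r ^ 2 * S r = r * T r := fun r hr ↦ by
    simp only [hS, hT, sphereIntegral_def]
    rw [← integral_const_mul, ← integral_const_mul]
    refine integral_congr_ae (ae_of_all _ fun α ↦ ?_)
    simp only [norm_smul_sphere hr.le α, inner_smul_left, RCLike.conj_to_real, smul_smul,
      inv_mul_cancel₀ hr.ne', one_smul]
    ring
  have hR : Tendsto (fun k ↦ b ^ 2 * S b - (a k) ^ 2 * S (a k)) atTop (𝓝 (b ^ 2 * S b)) := by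
    have h0 : Tendsto (fun k ↦ a k * T (a k)) atTop (𝓝 0) := by
      have h := ((continuous_id.mul hTc).tendsto 0).comp ha_tend
      rw [Pi.mul_apply, id_eq, zero_mul] at h
      exact h
    have h1 : Tendsto (fun k ↦ b ^ 2 * S b - a k * T (a k)) atTop (𝓝 (b ^ 2 * S b - 0)) :=
      tendsto_const_nhds.sub h0
    rw [sub_zero] at h1
    refine h1.congr fun k ↦ ?_
    rw [hST (a k) (ha_pos k)]
  -- the shell theorem for each `k`, and uniqueness of limits
  have heq : ∀ k, ∫ x in s k, dV x = b ^ 2 * S b - (a k) ^ 2 * S (a k) := fun k ↦ by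
    have h := setIntegral_shell_divergence_eq volume hV (ha_pos k) (ha_le k)
    rw [finrank_euclideanSpace_fin] at h
    exact h
  exact tendsto_nhds_unique (hL.congr heq) hR

/-- **Gauss–Green on a coordinate ball of `E3`.** For a global `C¹` field `V : E3 → E3`, `r > 0`:
`∫_{|y−ξ|<r} div V dy = ∮_{|y−ξ|=r} ⟪(y − ξ)/r, V(y)⟫ dμHE[2](y)` (translate to the origin,
`setIntegral_ball_zero_divergence`, and `μHE[2]` on the round sphere is `r²` times the polar surface
measure, `Hausdorff.setIntegral_sphere_euclideanHausdorff_three`). Evans–Gariepy 1992, §5.8, Thm. 1.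
[folklore] -/
theorem setIntegral_ball_divergence {V : E3 → E3} (hV : ContDiff ℝ 1 V) (ξ : E3) {r : ℝ}
    (hr : 0 < r) :
    ∫ y in ball ξ r, VectorCalculus.divergence V y =
      ∫ y in sphere ξ r, ⟪r⁻¹ • (y - ξ), V y⟫ ∂(μHE[2] : Measure E3) := by
  set W : E3 → E3 := fun x ↦ V (x + ξ) with hW
  have hWd : ContDiff ℝ 1 W := hV.comp (contDiff_id.add contDiff_const)
  have hdiv : ∀ x, VectorCalculus.divergence W x = VectorCalculus.divergence V (x + ξ) := fun x ↦ by
    simp only [VectorCalculus.divergence]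
    rw [fderiv_comp_add_right]
  -- bulk: translate to the origin
  have hL : ∫ y in ball ξ r, VectorCalculus.divergence V y =
      ∫ x in ball (0 : E3) r, VectorCalculus.divergence W x := by
    rw [setIntegral_eq_preimage_add_right ξ]
    have hpre : (fun x : E3 ↦ x + ξ) ⁻¹' ball ξ r = ball 0 r := by
      ext x
      simp [dist_eq_norm]
    rw [hpre]
    exact setIntegral_congr_fun measurableSet_ball fun x _ ↦ (hdiv x).symm
  -- surface: translate, then polar form of `μHE[2]` on the round sphere
  have hRHS : ∫ y in sphere ξ r, ⟪r⁻¹ • (y - ξ), V y⟫ ∂(μHE[2] : Measure E3) =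
      r ^ 2 * sphereIntegral volume (fun x ↦ ⟪‖x‖⁻¹ • x, W x⟫) r := by
    rw [setIntegral_sphere_euclideanHausdorff_add_right 2 ξ r,
      Literature.MeasureTheory.Hausdorff.setIntegral_sphere_euclideanHausdorff_three
        finrank_euclideanSpace_fin hr,
      smul_eq_mul]
    simp only [add_sub_cancel_right, sphereIntegral_def, hW]
    congr 1
    refine integral_congr_ae (ae_of_all _ fun α ↦ ?_)
    simp only [norm_smul_sphere hr.le α]
  rw [hL, setIntegral_ball_zero_divergence hWd hr, hRHS]

/-! ### Balls minus disjoint balls -/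

/-- The closed perforated region `{|y − c| ≤ R, |y − ξ_j| ≥ ρ_j ∀ j}` is the closed ball minus the
open holes. [folklore] -/
theorem perforated_eq_closedBall_diff {c : E3} {R : ℝ} {n : ℕ} {ξ : Fin n → E3} {ρ : Fin n → ℝ} :
    {y : E3 | dist y c ≤ R ∧ ∀ j, ρ j ≤ dist y (ξ j)} = closedBall c R \ ⋃ j, ball (ξ j) (ρ j) := by
  ext y
  simp only [mem_setOf_eq, Set.mem_sdiff, mem_closedBall, mem_iUnion, mem_ball, not_exists, not_lt]

/-- The closed perforated region and the open one `ball c R ∖ ⋃_j ball ξ_j ρ_j` differ by a subset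
of the Lebesgue-null sphere `{|y − c| = R}`. [folklore] -/
theorem perforated_ae_eq {c : E3} {R : ℝ} {n : ℕ} {ξ : Fin n → E3} {ρ : Fin n → ℝ} :
    ({y : E3 | dist y c ≤ R ∧ ∀ j, ρ j ≤ dist y (ξ j)} : Set E3) =ᵐ[volume]
      (ball c R \ ⋃ j, ball (ξ j) (ρ j) : Set E3) := by
  rw [perforated_eq_closedBall_diff]
  refine ae_eq_set.2 ⟨measure_mono_null ?_ (Measure.addHaar_sphere volume c R), ?_⟩
  · intro y hy
    have h1 : dist y c ≤ R := mem_closedBall.1 hy.1.1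
    have h2 : ¬ dist y c < R := fun h ↦ hy.2 ⟨mem_ball.2 h, hy.1.2⟩
    exact mem_sphere.2 (le_antisymm h1 (not_lt.1 h2))
  · rw [measure_eq_zero_iff_ae_notMem]
    refine ae_of_all _ fun y hy ↦ ?_
    exact hy.2 ⟨ball_subset_closedBall hy.1.1, hy.1.2⟩

/-- **Ball = perforated ball ⊔ holes.** For `f` integrable on the ball `{|y − c| < R}` and
finitely many pairwise disjoint holes `{|y − ξ_j| < ρ_j}` inside it,
`∫_{ball} f = ∫_{{|y−c| ≤ R, |y−ξ_j| ≥ ρ_j}} f + Σ_j ∫_{hole j} f`. [folklore] -/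
theorem setIntegral_ball_eq_perforated_add_sum {f : E3 → ℝ} {c : E3} {R : ℝ} {n : ℕ}
    {ξ : Fin n → E3} {ρ : Fin n → ℝ} (hf : IntegrableOn f (ball c R))
    (hin : ∀ j, dist (ξ j) c + ρ j ≤ R) (hdisj : ∀ j j', j ≠ j' → ρ j + ρ j' ≤ dist (ξ j) (ξ j')) :
    ∫ y in ball c R, f y =
      (∫ y in {y : E3 | dist y c ≤ R ∧ ∀ j, ρ j ≤ dist y (ξ j)}, f y) +
        ∑ j, ∫ y in ball (ξ j) (ρ j), f y := by
  have hsub : (⋃ j, ball (ξ j) (ρ j)) ⊆ ball c R := by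
    refine iUnion_subset fun j y hy ↦ ?_
    rw [mem_ball] at hy ⊢
    calc dist y c ≤ dist y (ξ j) + dist (ξ j) c := dist_triangle _ _ _
      _ < ρ j + dist (ξ j) c := by linarith
      _ ≤ R := by linarith [hin j]
  have hmeas : MeasurableSet (⋃ j, ball (ξ j) (ρ j)) := MeasurableSet.iUnion fun j ↦ measurableSet_ball
  rw [setIntegral_congr_set perforated_ae_eq, setIntegral_sdiff hmeas hf hsub,
    integral_iUnion_fintype (fun j ↦ measurableSet_ball) ?_ fun j ↦ hf.mono_set ?_]
  · ring
  · intro j j' hjj'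
    exact ball_disjoint_ball (hdisj j j' hjj')
  · exact (subset_iUnion (fun j ↦ ball (ξ j) (ρ j)) j).trans hsub


/-- **Gauss–Green on a coordinate ball of `E3`**, registered form (sub-goal `gaussGreen_ball` of
the crux item): `∫_{|y−ξ|<r} div V = ∮_{|y−ξ|=r} ⟪(y − ξ)/r, V⟫ dμHE[2]` for a global `C¹` field.
Evans–Gariepy 1992, §5.8, Thm. 1. [folklore] -/
theorem gaussGreen_ball : open Literature.Geometry.Lorentzian Literature.Analysis.FluidPDE MeasureTheory Metric in ∀ (V : E3 → E3) (ξ : E3) (r : ℝ), ContDiff ℝ 1 V → 0 < r → ∫ y in ball ξ r, VectorCalculus.divergence V y = ∫ y in sphere ξ r, inner ℝ (r⁻¹ • (y - ξ)) (V y) ∂(μHE[2] : Measure E3) :=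
  fun _V ξ _r hV hr ↦ setIntegral_ball_divergence hV ξ hr

end LLGauss

end Summit.FinalStateConjecture.FinalStateConjecture.Theorems

end
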